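import Mathlib
import Summits.NavierStokesRegularity.NavierStokesRegularity.Theorems.TaoLadderRungTwoFlatCoreContractZ
import HarnessLib

/-!
# GAP DATA FROM THE HOP OBLIGATIONS, BY PHASE (capture hops `n < N₀`, entry hop `n = N₀`, tube hops `n > N₀`), and the
  statics / existence clauses of a STRONGER slot (the split R54 tube) from those of a weaker one
  (helper for the K_A♭ parent item stmt-NavierStokesRegularity-22987 `FlatGapCertificatesV2`, child 2A `GradedAdiabaticWakeA` of
  route TaoLadderRungTwoFlat; cell harvest/h2-tao-ladder, p1 g25; LADDER §50, §57.5, §64.2)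

`HopTube.gapData₂On_of_tubeWith` consumes the four per-hop obligations for EVERY `n`; their producers come by phase
(tube hops `n > N₀`: `tubeStep_of_schedule_split`, one call; entry hop `n = N₀`: the hand-over of `…EntryHandover`; capture hops
`n < N₀`: finite-time continuity). This module re-cuts the composition along that case split, and transfers the two STATIC
inputs (`TubeStaticsWith`, `TubeExistWith`) from a slot `Bcl` to any stronger slot `Bcl' → Bcl` (the described set only shrinks),
so that the R54 statics `tubeStaticsWith_R54_tubeWeight` serve the split tube `splitBcl P (behindR54 P θ′ Wb) δs i₀ u⋆` verbatim.

* `tubeSetWith_mono_slot`, `tubeStaticsWith_mono_slot`, `tubeExistWith_mono_slot`, `tubeStaticsWith_split`, `tubeExistWith_split`;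
* `gapData₂On_of_phases` — statics + existence + (capture phase) + (entry hop) + (tube hops) ⇒ `GapData₂On … (tubeSetWith …) … 0 …`;
* `gradedWake_clause_of_phases` — the `∃`-clause of child 2A's conclusion at one `ε₀`, given `TailThin`.

HONEST FRAMING: pure logic/bookkeeping over the cell's typed induction frame (MODEL lattice); the phase obligations remain
HYPOTHESES; nothing certified; no item closed; nothing about the Navier–Stokes equations.
-/

noncomputable section

-- the sub-problem namespace repeats the summit name by design (D-0017)
set_option linter.dupNamespace false

namespace Summit.NavierStokesRegularity.NavierStokesRegularity.Theorems.HopTube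

open Set Finset Literature.Analysis.FluidPDE Literature.Analysis.FluidPDE.TaoCascade MirrorPulse

/-! ## Statics and existence pass to a stronger slot -/

section SlotStatics

variable {P : TubeSchedule} {Bcl Bcl' : ℕ → (Fin 2 → ℤ → ℝ) → Prop} {i₀ : Fin 2} {X₀ : Fin 2 → ℝ} {w : ℤ → ℝ} {r : ℝ}
  {ζ : ℕ → Fin 2 → ℤ → ℝ} {ustar : Fin 2 → ℤ → ℝ}

/-- The described set shrinks with the slot. [folklore (definitional); cell LADDER §57.5] -/
theorem tubeSetWith_mono_slot (h : ∀ n z, Bcl' n z → Bcl n z) :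
    tubeSetWith P Bcl' i₀ X₀ w r ζ ustar ⊆ tubeSetWith P Bcl i₀ X₀ w r ζ ustar :=
  fun _ ⟨n, hz⟩ => ⟨n, inTubeWith_mono_slot h hz⟩

/-- `TubeStaticsWith` passes to a stronger slot (every static clause quantifies over the described set).
[cite: Tao2016AveragedNS, §6.2–6.4 (statement shape); cell LADDER §57.5, §64.2] -/
theorem tubeStaticsWith_mono_slot {σ ε₀ θ₀ θ c₀ c : ℝ} {env₀ : ℤ → ℝ} (h : ∀ n z, Bcl' n z → Bcl n z)
    (H : TubeStaticsWith P Bcl σ ε₀ i₀ X₀ w r θ₀ c₀ env₀ ζ ustar θ c) :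
    TubeStaticsWith P Bcl' σ ε₀ i₀ X₀ w r θ₀ c₀ env₀ ζ ustar θ c := by
  obtain ⟨hr, hθ0, hθ, hθh, hc0, hc, hσ, hw, hfat, htame, hcompat⟩ := H
  have hsub := tubeSetWith_mono_slot (P := P) (i₀ := i₀) (X₀ := X₀) (w := w) (r := r) (ζ := ζ) (ustar := ustar) h
  refine ⟨hr, hθ0, hθ, hθh, hc0, hc, hσ, hw, ?_, ?_, ?_⟩
  · obtain ⟨k₁, hk⟩ := hfat
    exact ⟨k₁, fun k hk' => ⟨(hk k hk').1, fun z hz i => (hk k hk').2 z (hsub hz) i⟩⟩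
  · obtain ⟨C, hC1, hC2⟩ := htame
    exact ⟨C, fun z hz i k => hC1 z (hsub hz) i k, hC2⟩
  · obtain ⟨k₁, K₀, C₄, hk⟩ := hcompat
    exact ⟨k₁, K₀, C₄, fun k hk' =>
      ⟨(hk k hk').1, fun z hz i => (hk k hk').2.1 z (hsub hz) i, (hk k hk').2.2.1, (hk k hk').2.2.2⟩⟩

/-- `TubeExistWith` passes to a stronger slot (the ball around the smaller set is smaller).
[cite: Tao2016AveragedNS, §4 Lemma 4.1 (local theory, statement shape); cell LADDER §47.5 L2, §57.5] -/
theorem tubeExistWith_mono_slot {𝕊 : Finset (ℤ × ℤ × ℤ)} {ε₀ : ℝ} {α : Fin 2 → Fin 2 → Fin 2 → ℤ × ℤ × ℤ → ℝ} {c : ℝ}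
    (h : ∀ n z, Bcl' n z → Bcl n z) (H : TubeExistWith P Bcl 𝕊 ε₀ i₀ α X₀ w r ζ ustar c) :
    TubeExistWith P Bcl' 𝕊 ε₀ i₀ α X₀ w r ζ ustar c := by
  intro S₀ hball
  obtain ⟨z, hz, hkick⟩ := hball
  exact H S₀ ⟨z, tubeSetWith_mono_slot h hz, hkick⟩

/-- The split tube inherits the statics of the slot it refines. [cite: Tao2016AveragedNS, §6.2–6.4 (statement shape); cell LADDER §64.2 (P-64a)] -/
theorem tubeStaticsWith_split {δs : ℕ → ℝ} {σ ε₀ θ₀ θ c₀ c : ℝ} {env₀ : ℤ → ℝ}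
    (H : TubeStaticsWith P Bcl σ ε₀ i₀ X₀ w r θ₀ c₀ env₀ ζ ustar θ c) :
    TubeStaticsWith P (splitBcl P Bcl δs i₀ ustar) σ ε₀ i₀ X₀ w r θ₀ c₀ env₀ ζ ustar θ c :=
  tubeStaticsWith_mono_slot (splitBcl_fst P Bcl δs i₀ ustar) H

/-- The split tube inherits the existence clause of the slot it refines. [cite: Tao2016AveragedNS, §4 Lemma 4.1 (statement shape); cell LADDER §64.2 (P-64a)] -/
theorem tubeExistWith_split {δs : ℕ → ℝ} {𝕊 : Finset (ℤ × ℤ × ℤ)} {ε₀ : ℝ}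
    {α : Fin 2 → Fin 2 → Fin 2 → ℤ × ℤ × ℤ → ℝ} {c : ℝ} (H : TubeExistWith P Bcl 𝕊 ε₀ i₀ α X₀ w r ζ ustar c) :
    TubeExistWith P (splitBcl P Bcl δs i₀ ustar) 𝕊 ε₀ i₀ α X₀ w r ζ ustar c :=
  tubeExistWith_mono_slot (splitBcl_fst P Bcl δs i₀ ustar) H

end SlotStatics

/-! ## The composition by phase -/

section Phases

variable (P : TubeSchedule) (Bcl : ℕ → (Fin 2 → ℤ → ℝ) → Prop) (rule : HopRule)
  {𝕊 : Finset (ℤ × ℤ × ℤ)} {σ ε₀ : ℝ} {i₀ : Fin 2} {α : Fin 2 → Fin 2 → Fin 2 → ℤ × ℤ × ℤ → ℝ} {X₀ : Fin 2 → ℝ}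
  {w : ℤ → ℝ} {r θ₀ θ c₀ c : ℝ} {env₀ : ℤ → ℝ} {ζ : ℕ → Fin 2 → ℤ → ℝ} {ustar : Fin 2 → ℤ → ℝ}

/-- **`H(n)`-INDUCTION ⇒ GAP DATA, BY PHASE.** Statics + existence + the CAPTURE phase (`n < N₀`: clock, envelope, capture) + the
ENTRY hop (`n = N₀`: clock, envelope, landing from a capture premise) + the TUBE hops (`n > N₀`: clock, envelope, landing — one call
each by `tubeStep_of_schedule_split`) give format-v2 gap data with `Z := tubeSetWith …`, `ρ := 0`.
[cite: Tao2016AveragedNS, §6.3–6.4 Props. 6.4–6.5 (statement shape); cell LADDER §50, §57.5] -/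
theorem gapData₂On_of_phases
    (hstat : TubeStaticsWith P Bcl σ ε₀ i₀ X₀ w r θ₀ c₀ env₀ ζ ustar θ c)
    (hexist : TubeExistWith P Bcl 𝕊 ε₀ i₀ α X₀ w r ζ ustar c)
    (hcapture : ∀ n, n < P.N₀ →
      TubeStepClockWith P Bcl rule 𝕊 σ ε₀ i₀ α X₀ w r θ₀ c₀ ζ ustar n ∧
        TubeStepEnvelopeWith P Bcl rule 𝕊 ε₀ i₀ α X₀ w r c₀ env₀ ζ ustar n ∧
        TubeStepCaptureWith P Bcl rule 𝕊 ε₀ i₀ α X₀ w r c₀ ζ ustar n)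
    (hentry : TubeStepClockWith P Bcl rule 𝕊 σ ε₀ i₀ α X₀ w r θ₀ c₀ ζ ustar P.N₀ ∧
      TubeStepEnvelopeWith P Bcl rule 𝕊 ε₀ i₀ α X₀ w r c₀ env₀ ζ ustar P.N₀ ∧
      TubeStepLandWith P Bcl rule 𝕊 ε₀ i₀ α X₀ w r c₀ ζ ustar P.N₀)
    (htube : ∀ n, P.N₀ < n →
      TubeStepClockWith P Bcl rule 𝕊 σ ε₀ i₀ α X₀ w r θ₀ c₀ ζ ustar n ∧
        TubeStepEnvelopeWith P Bcl rule 𝕊 ε₀ i₀ α X₀ w r c₀ env₀ ζ ustar n ∧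
        TubeStepLandWith P Bcl rule 𝕊 ε₀ i₀ α X₀ w r c₀ ζ ustar n) :
    GapData₂On 𝕊 σ ε₀ i₀ α X₀ (tubeSetWith P Bcl i₀ X₀ w r ζ ustar) w r 0 θ₀ θ c₀ c env₀ := by
  refine gapData₂On_of_tubeWith P Bcl rule hstat hexist (fun n => ?_) (fun n => ?_) (fun n hn => ?_) (fun n hn => ?_)
  · rcases lt_trichotomy n P.N₀ with h | h | h
    · exact (hcapture n h).1
    · subst h; exact hentry.1
    · exact (htube n h).1
  · rcases lt_trichotomy n P.N₀ with h | h | h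
    · exact (hcapture n h).2.1
    · subst h; exact hentry.2.1
    · exact (htube n h).2.1
  · exact (hcapture n (by omega)).2.2
  · rcases eq_or_lt_of_le hn with h | h
    · subst h; exact hentry.2.2
    · exact (htube n h).2.2

/-- The child-2 shape, by phase: the same data for the graded MIRROR table give the `∃`-clause of `GradedAdiabaticWake`'s conclusion
at that `ε₀` (`ρ' = 0`), given `TailThin`. [cite: Tao2016AveragedNS, §6.3–6.4 (statement shape); cell LADDER §50, §57.5; route TaoLadderRungTwoFlat item GradedAdiabaticWake] -/
theorem gradedWake_clause_of_phases {ε : ℝ}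
    (hstat : TubeStaticsWith P Bcl σ ε₀ i₀ X₀ w r θ₀ c₀ env₀ ζ ustar θ c)
    (hexist : TubeExistWith P Bcl shiftSetFlat ε₀ i₀ (mirrorTable ε ε) X₀ w r ζ ustar c)
    (hcapture : ∀ n, n < P.N₀ →
      TubeStepClockWith P Bcl rule shiftSetFlat σ ε₀ i₀ (mirrorTable ε ε) X₀ w r θ₀ c₀ ζ ustar n ∧
        TubeStepEnvelopeWith P Bcl rule shiftSetFlat ε₀ i₀ (mirrorTable ε ε) X₀ w r c₀ env₀ ζ ustar n ∧
        TubeStepCaptureWith P Bcl rule shiftSetFlat ε₀ i₀ (mirrorTable ε ε) X₀ w r c₀ ζ ustar n)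
    (hentry : TubeStepClockWith P Bcl rule shiftSetFlat σ ε₀ i₀ (mirrorTable ε ε) X₀ w r θ₀ c₀ ζ ustar P.N₀ ∧
      TubeStepEnvelopeWith P Bcl rule shiftSetFlat ε₀ i₀ (mirrorTable ε ε) X₀ w r c₀ env₀ ζ ustar P.N₀ ∧
      TubeStepLandWith P Bcl rule shiftSetFlat ε₀ i₀ (mirrorTable ε ε) X₀ w r c₀ ζ ustar P.N₀)
    (htube : ∀ n, P.N₀ < n →
      TubeStepClockWith P Bcl rule shiftSetFlat σ ε₀ i₀ (mirrorTable ε ε) X₀ w r θ₀ c₀ ζ ustar n ∧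
        TubeStepEnvelopeWith P Bcl rule shiftSetFlat ε₀ i₀ (mirrorTable ε ε) X₀ w r c₀ env₀ ζ ustar n ∧
        TubeStepLandWith P Bcl rule shiftSetFlat ε₀ i₀ (mirrorTable ε ε) X₀ w r c₀ ζ ustar n)
    (hthin : TailThin ε₀ w r) :
    ∃ (σ' : ℝ) (Z : Set (Fin 2 → ℤ → ℝ)) (w' : ℤ → ℝ) (r' ρ' θ₀' θ' c₀' c' : ℝ) (env₀' : ℤ → ℝ),
      GapData₂On shiftSetFlat σ' ε₀ i₀ (mirrorTable ε ε) X₀ Z w' r' ρ' θ₀' θ' c₀' c' env₀' ∧ TailThin ε₀ w' r' :=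
  ⟨σ, tubeSetWith P Bcl i₀ X₀ w r ζ ustar, w, r, 0, θ₀, θ, c₀, c, env₀,
    gapData₂On_of_phases P Bcl rule hstat hexist hcapture hentry htube, hthin⟩

end Phases

end Summit.NavierStokesRegularity.NavierStokesRegularity.Theorems.HopTube

end
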